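import Summits.BirchSwinnertonDyer.Rank1Residual.AdditivePotMult.PrimeToPDescent
import Summits.BirchSwinnertonDyer.Rank1Residual.AdditivePotMult.TwistTransportLocal
import Summits.BirchSwinnertonDyer.Rank1Residual.AdditivePotMult.VariableChangeSelmerOver
import HarnessLib

/-!
# The Selmer-level transport [C]: `Sel_{p^∞}(E/ℚ_∞) ≅ Sel_{p^∞}(E♭/K·ℚ_∞)^{(χ_K)}` for a quadratic twist `E = E♭ ⊗ χ_K` — kernel bricks 1 + 2 assembled (cell `b2b-bsdres`, seat additive-p1, gen 8)

HONEST FRAMING (cell `b2b-bsdres`, run/shared/lean/b2b/bsd-rank1-residual/, verbatim in every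
file): the goal of the cell is to DELETE the COMBINATION-SHAPED residual classes of the
Birch–Swinnerton-Dyer formula for ALL analytic-rank `≤ 1` elliptic curves over `ℚ` — "full BSD
formula for every rank `≤ 1` curve in class `C`" assembled STRICTLY from published theorems — so
that the rank-`≤ 1` remainder becomes exactly the CONSTRUCTION-SHAPED classes, which are TYPED
(missing-input `Prop`s), NOT attempted. This is not "finishing BSD". The additive sub-cell (seats
additive-p1…p4) is a RESEARCH ROUTE on the construction-shaped classes X3/X4; sub-cell additive-p1
= the potentially MULTIPLICATIVE additive prime (X3♯(M) / X4(M)); no claim beyond the stated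
classes; the labels of X3/X4 are UNCHANGED by this file; nothing is booked.

Definitions = concrete subgroups / additive isomorphisms (no predicate, no named fact) and
theorems. Context: design HOME/b2b-bsdres-additive-p1/KERNEL-C-P3.md. The typed input
`ChiBranchLeadingTerm[Odd][BigImage]At W p` (`Additive/ChiBranchInput*.lean`) behind the rank-`0`
upper half on X3♯(M)/X4(M) is [B∘C]: [B] = Wuthrich 2014 Thm 16 / Kato 17.4(3) COMPONENTWISE
(printed), [C] = the transport `X(E/ℚ_∞) ≅ e_χ X(E♭/ℚ(μ_{p^∞}))` (folklore, unprinted for the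
twist). THIS FILE assembles the SELMER-LEVEL form of [C] from the kernel bricks landed this
generation:

* `chiEigenSelmer V K p κ` — the `χ_K`-eigenspace of `Sel_{p^∞}(E♭/K·ℚ_∞)`: classes of
  `V.selmerGroupOver p (ker κ ⊓ galRange K)` on which every `g ∈ Gal(ℚ̄/ℚ_∞)` acts by
  `χ_K(g) = ±1` (`quadSign`);
* `twistDescentEquiv … : W.selmerInfty κ ≃+ chiEigenSelmer V K p κ` for ANY model
  `C • V^{(c)} = W` of the twist, `p` odd: change of model (`VariableChangeSelmerOver`,
  brick 2c) ∘ prime-to-`p` Galois descent `Sel(V^{(c)}/ℚ_∞) ≅ Sel(V^{(c)}/K·ℚ_∞)^{Gal}`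
  (`PrimeToPDescent`, brick 1, Greenberg LNM 1716 p. 143) ∘ the twist over `K·ℚ_∞ ∋ √c` with the
  sign rule (`TwistTransportLocal`, brick 2);
* `coe_twistDescentEquiv_conjH1` — Galois bookkeeping: the transport is `Gal(ℚ̄/K)`-equivariant
  and anti-equivariant off `Gal(ℚ̄/K)` (so the `Λ`-structures for a topological generator of `Γ`
  chosen inside `Gal(ℚ̄/K)` agree — input of brick 3, the `Λ`-dual packaging, NOT in this file).

For `(E, p)` additive potentially multiplicative (resp. potentially good ordinary), `c = p*`,
`V = E♭` the `p`-semistable twist, `K = ℚ(√p*)`: at `p = 3`, `K·ℚ_∞ = ℚ(μ_{3^∞})` and this is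
`Sel_{3^∞}(E/ℚ_∞) ≅ Sel_{3^∞}(E♭/ℚ(μ_{3^∞}))^{(ω)}`; at `p ≥ 5` it is the descent to the quadratic
subfield `ℚ_∞(√p*)` of `ℚ(μ_{p^∞})` (the remaining prime-to-`p` descent `ℚ(μ_{p^∞}) → ℚ_∞(√p*)` is
again `PrimeToPDescent`). What is still missing before `ChiBranchLeadingTermOddAt W 3` becomes a
theorem: brick 3 (`Λ`-dual of `chiEigenSelmer`, `IwasawaDual.IsLocNil.module`), brick 4 (the
componentwise reading of Wuthrich Thm 16 / Kato 17.4(3) at `p = 3` in this vocabulary), brick 5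
(assembly) — see the design file.

References: R. Greenberg, LNM 1716 (1999), §5 p. 143 [GreenbergLNM1716]; T. Dokchitser, *Notes on
the parity conjecture* (2013), §4 [Dokchitser2013ParityNotes]; T. Dokchitser, V. Dokchitser, Ann.
of Math. 172 (2010), Lemma 4.14 [DokchitserDokchitserAnnals2010].
-/

noncomputable section

open scoped Classical

namespace Summit.BirchSwinnertonDyer.Rank1Residual.AdditivePotMult

open Literature.NumberTheory.EllipticCurves Literature.NumberTheory.GaloisRepresentations
  WeierstrassCurve

/-! ## §A Precise conjugation rules for `ψ̃_*` -/

section ConjRules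

variable (W : WeierstrassCurve ℚ) (K : Type) [Field K] [NumberField K]
  (h2 : Module.finrank ℚ K = 2) {θ : K} {c : ℚ} (hθ : θ ∉ Set.range (algebraMap ℚ K))
  (hc : θ ^ 2 = algebraMap ℚ K c) (p : ℕ)
  (H : Subgroup (Field.absoluteGaloisGroup ℚ)) (hH : H ≤ galRange (K := ℚ) K) [H.Normal]

/-- `ψ̃_* (σ_* s) = σ_* (ψ̃_* s)` for `σ ∈ galRange K`. [folklore] -/
theorem twistSubgroupH1EquivGeom_conjH1_of_mem {σ : Field.absoluteGaloisGroup ℚ}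
    (hσ : σ ∈ galRange (K := ℚ) K) (s : (W.quadraticTwist c).subgroupH1 p H) :
    twistSubgroupH1EquivGeom W K hθ hc p H hH ((W.quadraticTwist c).conjH1 p H σ s) =
      W.conjH1 p H σ (twistSubgroupH1EquivGeom W K hθ hc p H hH s) := by
  obtain ⟨f, rfl⟩ := oneCocycleClass_surjective _ s
  change h1Equiv _ _ (conjH1 H _ σ _) = conjH1 H _ σ (h1Equiv _ _ _)
  rw [conjH1_oneCocycleClass, h1Equiv_apply, h1Equiv_apply, resH1Hom_id_oneCocycleClass,
    resH1Hom_id_oneCocycleClass, conjH1_oneCocycleClass]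
  congr 1
  apply Subtype.ext
  ext n : 1
  rw [contOneCocycles.push_apply, conjCocycle_apply]
  change twistPrimaryEquiv W K hθ hc p (σ • f.1 (subgroupConj H σ n)) =
    (conjCocycle H σ (contOneCocycles.push
      (twistPrimaryEquiv W K hθ hc p : _ →+ _) (twistPrimaryEquiv_smul_of_le W K hθ hc p hH) f)).1 n
  rw [conjCocycle_apply, contOneCocycles.push_apply]
  exact twistPrimaryEquiv_smul_of_mem W K hθ hc p hσ _

include h2 in
/-- `ψ̃_* (σ_* s) = −σ_* (ψ̃_* s)` for `σ ∉ galRange K` (the quadratic character).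
[cite: Dokchitser2013ParityNotes, §4] -/
theorem twistSubgroupH1EquivGeom_conjH1_of_not_mem {σ : Field.absoluteGaloisGroup ℚ}
    (hσ : σ ∉ galRange (K := ℚ) K) (s : (W.quadraticTwist c).subgroupH1 p H) :
    twistSubgroupH1EquivGeom W K hθ hc p H hH ((W.quadraticTwist c).conjH1 p H σ s) =
      -W.conjH1 p H σ (twistSubgroupH1EquivGeom W K hθ hc p H hH s) :=
  h1Equiv_conjH1_neg (N := H) (twistPrimaryEquiv W K hθ hc p)
    (twistPrimaryEquiv_smul_of_le W K hθ hc p hH)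
    (fun m ↦ twistPrimaryEquiv_smul_of_not_mem W K h2 hθ hc p hσ m) _

end ConjRules

/-! ## §B The Selmer-level transport [C]: `Sel_{p^∞}(E/ℚ_∞) ≅ Sel_{p^∞}(E♭/K·ℚ_∞)^{(χ_K)}` -/

section Descent

variable (V : WeierstrassCurve ℚ) (K : Type) [Field K] [NumberField K]
  (h2 : Module.finrank ℚ K = 2) {θ : K} {c : ℚ} (hθ : θ ∉ Set.range (algebraMap ℚ K))
  (hc : θ ^ 2 = algebraMap ℚ K c) (p : ℕ) [Fact p.Prime] (κ : ZpExtension ℚ p)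
  [(galRange (K := ℚ) K).Normal]

omit [(galRange (K := ℚ) K).Normal] in
/-- The quadratic character of `K` on `Γ_ℚ`, as a sign: `1` on `Gal(ℚ̄/K) = galRange K`, `−1` off
it. [folklore] -/
def quadSign (g : Field.absoluteGaloisGroup ℚ) : ℤ := if g ∈ galRange (K := ℚ) K then 1 else -1

omit [(galRange (K := ℚ) K).Normal] in
/-- `quadSign g = 1` on `galRange K`. [folklore] -/
theorem quadSign_of_mem {g : Field.absoluteGaloisGroup ℚ} (hg : g ∈ galRange (K := ℚ) K) :
    quadSign K g = 1 := if_pos hg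

omit [(galRange (K := ℚ) K).Normal] in
/-- `quadSign g = -1` off `galRange K`. [folklore] -/
theorem quadSign_of_not_mem {g : Field.absoluteGaloisGroup ℚ} (hg : g ∉ galRange (K := ℚ) K) :
    quadSign K g = -1 := if_neg hg

/-- **`Sel_{p^∞}(E♭/K·ℚ_∞)^{(χ_K)}`**: the classes of `Sel_{p^∞}(V/ℚ̄^{ker κ ⊓ galRange K})` on which
every `g ∈ Gal(ℚ̄/ℚ_∞) = ker κ` acts through the quadratic character of `K` — the
`χ_K`-eigenspace of the `Gal(K·ℚ_∞/ℚ_∞) = Δ`-action (for `K = ℚ(√p*)`: the `ω^{(p−1)/2}`-eigenspace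
of `Sel_{p^∞}(E♭/ℚ_∞(√p*))`, at `p = 3` of `Sel_{3^∞}(E♭/ℚ(μ_{3^∞}))`). [folklore] -/
def chiEigenSelmer : AddSubgroup (V.subgroupH1 p (κ.kerSubgroup ⊓ galRange (K := ℚ) K)) where
  carrier := {t | t ∈ V.selmerGroupOver p (κ.kerSubgroup ⊓ galRange (K := ℚ) K) ∧
    ∀ g : κ.kerSubgroup, V.conjH1 p _ (g : Field.absoluteGaloisGroup ℚ) t = quadSign K g • t}
  zero_mem' := ⟨zero_mem _, fun g ↦ by rw [map_zero, zsmul_zero]⟩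
  add_mem' := fun {a b} ha hb ↦
    ⟨add_mem ha.1 hb.1, fun g ↦ by rw [map_add, ha.2 g, hb.2 g, zsmul_add]⟩
  neg_mem' := fun {a} ha ↦ ⟨neg_mem ha.1, fun g ↦ by rw [map_neg, ha.2 g, zsmul_neg]⟩

/-- Membership in `chiEigenSelmer`. [folklore] -/
theorem mem_chiEigenSelmer_iff (t : V.subgroupH1 p (κ.kerSubgroup ⊓ galRange (K := ℚ) K)) :
    t ∈ chiEigenSelmer V K p κ ↔
      t ∈ V.selmerGroupOver p (κ.kerSubgroup ⊓ galRange (K := ℚ) K) ∧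
        ∀ g : κ.kerSubgroup,
          V.conjH1 p _ (g : Field.absoluteGaloisGroup ℚ) t = quadSign K g • t :=
  Iff.rfl

variable {V K p κ}

include h2 in
/-- The twist `ψ̃_*` carries the `Gal(ℚ̄/ℚ_∞)`-INVARIANT Selmer classes of `V^{(c)}` over
`K·ℚ_∞` exactly onto `chiEigenSelmer` (invariance becomes `χ_K`-variance by the sign rule).
[cite: Dokchitser2013ParityNotes, §4] -/
theorem mem_chiEigenSelmer_iff_twist
    (s : (V.quadraticTwist c).subgroupH1 p (κ.kerSubgroup ⊓ galRange (K := ℚ) K)) :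
    twistSubgroupH1EquivGeom V K hθ hc p _ inf_le_right s ∈ chiEigenSelmer V K p κ ↔
      s ∈ (V.quadraticTwist c).selmerGroupOverRelInvariants p
        (κ.kerSubgroup ⊓ galRange (K := ℚ) K) κ.kerSubgroup := by
  rw [mem_chiEigenSelmer_iff, mem_selmerGroupOverRelInvariants_iff,
    ← mem_selmerGroupOver_iff_twist V K h2 hθ hc p _ inf_le_right s]
  refine and_congr Iff.rfl (forall_congr' fun g ↦ ?_)
  by_cases hg : (g : Field.absoluteGaloisGroup ℚ) ∈ galRange (K := ℚ) K
  · rw [quadSign_of_mem K hg, one_smul,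
      ← twistSubgroupH1EquivGeom_conjH1_of_mem V K hθ hc p _ inf_le_right hg,
      (twistSubgroupH1EquivGeom V K hθ hc p _ inf_le_right).apply_eq_iff_eq]
  · have hrule := twistSubgroupH1EquivGeom_conjH1_of_not_mem V K h2 hθ hc p _ inf_le_right hg s
    rw [quadSign_of_not_mem K hg, neg_one_zsmul, ← neg_eq_iff_eq_neg.mpr hrule, neg_inj,
      (twistSubgroupH1EquivGeom V K hθ hc p _ inf_le_right).apply_eq_iff_eq]

variable (V K p κ)
variable [(V.quadraticTwist c).IsElliptic] {W : WeierstrassCurve ℚ} {C : VariableChange ℚ}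
  (hCW : C • V.quadraticTwist c = W)

include h2 hθ hc in
/-- **Step (ii)**: `ψ̃_*` restricted — the `Gal(ℚ̄/ℚ_∞)`-invariant Selmer classes of `V^{(c)}`
over `K·ℚ_∞` ≃ `chiEigenSelmer` (twist with the sign rule). [cite: Dokchitser2013ParityNotes, §4] -/
def relInvariantsEquivChiEigen :
    (V.quadraticTwist c).selmerGroupOverRelInvariants p
        (κ.kerSubgroup ⊓ galRange (K := ℚ) K) κ.kerSubgroup ≃+ chiEigenSelmer V K p κ where
  toFun s := ⟨twistSubgroupH1EquivGeom V K hθ hc p _ inf_le_right s,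
    (mem_chiEigenSelmer_iff_twist (V := V) (p := p) (κ := κ) h2 hθ hc
      (s : (V.quadraticTwist c).subgroupH1 p (κ.kerSubgroup ⊓ galRange (K := ℚ) K))).mpr s.2⟩
  invFun t := ⟨(twistSubgroupH1EquivGeom V K hθ hc p _ inf_le_right).symm t, by
    have h := (mem_chiEigenSelmer_iff_twist (V := V) (p := p) (κ := κ) h2 hθ hc
      ((twistSubgroupH1EquivGeom V K hθ hc p _ inf_le_right).symm
        (t : V.subgroupH1 p (κ.kerSubgroup ⊓ galRange (K := ℚ) K)))).mp
    rw [AddEquiv.apply_symm_apply] at h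
    exact h t.2⟩
  left_inv s := Subtype.ext
    ((twistSubgroupH1EquivGeom V K hθ hc p _ inf_le_right).symm_apply_apply _)
  right_inv t := Subtype.ext
    ((twistSubgroupH1EquivGeom V K hθ hc p _ inf_le_right).apply_symm_apply _)
  map_add' s s' := Subtype.ext (map_add _ _ _)

omit [(galRange (K := ℚ) K).Normal] in
include h2 hθ hc in
/-- `p ∤ [Γ_ℚ : Gal(ℚ̄/K)] = 2` for `p` odd. [folklore] -/
theorem coprime_index_galRange (hp2 : p ≠ 2) : (galRange (K := ℚ) K).index.Coprime p := by
  haveI : IsGalois ℚ K := isGalois_of_finrank_eq_two K h2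
  rw [index_galRange K h2 (sigmaQ_ne_one K h2 hθ hc)]
  exact Nat.coprime_two_left.mpr ((Fact.out : p.Prime).odd_of_ne_two hp2)

include h2 hθ hc in
/-- **Step (i)** (brick 1, `PrimeToPDescent`): restriction
`Sel_{p^∞}(V^{(c)}/ℚ_∞) ≃+ Sel_{p^∞}(V^{(c)}/K·ℚ_∞)^{Gal(ℚ̄/ℚ_∞)}` for `p` odd.
[cite: GreenbergLNM1716, §5 p. 143] -/
def relRestrictionEquiv (hp2 : p ≠ 2) :
    (V.quadraticTwist c).selmerGroupOver p κ.kerSubgroup ≃+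
      (V.quadraticTwist c).selmerGroupOverRelInvariants p
        (κ.kerSubgroup ⊓ galRange (K := ℚ) K) κ.kerSubgroup :=
  AddEquiv.ofBijective
    ((V.quadraticTwist c).selmerRelRestriction p
      (inf_le_left : κ.kerSubgroup ⊓ galRange (K := ℚ) K ≤ κ.kerSubgroup))
    (selmerInfty_relRestriction_bijective (V.quadraticTwist c) p κ (isOpen_galRange K)
      (coprime_index_galRange K h2 hθ hc p hp2))

include h2 hθ hc hCW in
/-- **The Selmer-level transport [C] (kernel bricks 1 + 2 + 2c):
`Sel_{p^∞}(E/ℚ_∞) ≃+ Sel_{p^∞}(E♭/K·ℚ_∞)^{(χ_K)}`.** For an elliptic curve `V = E♭` over `ℚ`, a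
quadratic field `K = ℚ(θ)`, `θ² = c`, an odd prime `p` with its `ℤ_p`-extension datum `κ`
(`ℚ_∞ = ℚ̄^{ker κ}`), and ANY model `W = E` of the twist, `C • V^{(c)} = W`: the `p^∞`-Selmer group
of `E` over `ℚ_∞` (`W.selmerInfty κ`) is isomorphic to the `χ_K`-eigenspace `chiEigenSelmer` of the
`p^∞`-Selmer group of `E♭` over `K·ℚ_∞` — change of model (`VariableChangeSelmerOver`), prime-to-`p`
Galois descent along `K·ℚ_∞/ℚ_∞` (`PrimeToPDescent`, Greenberg p. 143), the twist over
`K·ℚ_∞ ∋ θ` with the sign rule (`TwistTransportLocal`). For `K = ℚ(√p*)`, `p = 3`: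
`K·ℚ_∞ = ℚ(μ_{3^∞})` and this is `Sel_{3^∞}(E/ℚ_∞) ≅ Sel_{3^∞}(E♭/ℚ(μ_{3^∞}))^{(ω)}` — the
Selmer-level form of [C] behind `ChiBranchLeadingTermOddAt W 3` (design KERNEL-C-P3.md; the
`Λ`-module packaging, brick 3, is not in this file). [cite: GreenbergLNM1716, §5 p. 143] -/
def twistDescentEquiv (hp2 : p ≠ 2) : W.selmerInfty κ ≃+ chiEigenSelmer V K p κ :=
  (((modelSelmerEquiv p hCW κ.kerSubgroup).symm.trans
    (relRestrictionEquiv (V := V) (K := K) (h2 := h2) (hθ := hθ) (hc := hc) (p := p) (κ := κ)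
      hp2)).trans
      (relInvariantsEquivChiEigen (V := V) (K := K) (h2 := h2) (hθ := hθ) (hc := hc) (p := p)
        (κ := κ)))

/-- The underlying class of `twistDescentEquiv s`: `ψ̃_* (res (m⁻¹ s))`. [folklore] -/
theorem coe_twistDescentEquiv (hp2 : p ≠ 2) (s : W.selmerInfty κ) :
    ((twistDescentEquiv V K h2 hθ hc p κ hCW hp2 s : chiEigenSelmer V K p κ) :
        V.subgroupH1 p (κ.kerSubgroup ⊓ galRange (K := ℚ) K)) =
      twistSubgroupH1EquivGeom V K hθ hc p _ inf_le_right
        ((V.quadraticTwist c).resOfLe p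
          (inf_le_left : κ.kerSubgroup ⊓ galRange (K := ℚ) K ≤ κ.kerSubgroup)
          ((modelSubgroupH1Equiv p hCW κ.kerSubgroup).symm
            (s : W.subgroupH1 p κ.kerSubgroup))) :=
  rfl

include h2 in
/-- **Galois bookkeeping of the transport**: for `g ∈ Γ_ℚ` and Selmer classes `s, s'` of `E`
over `ℚ_∞` with `s' = g_* s`, the transported classes satisfy `Θ s' = χ_K(g) · g_* (Θ s)` — so
`Θ` is equivariant for `g ∈ Gal(ℚ̄/K)` (in particular for a topological generator of `Γ` chosen
in `Gal(ℚ̄/K)`, the `Λ`-structures match) and anti-equivariant off it.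
[cite: Dokchitser2013ParityNotes, §4] -/
theorem coe_twistDescentEquiv_conjH1 (hp2 : p ≠ 2) (g : Field.absoluteGaloisGroup ℚ)
    (s s' : W.selmerInfty κ)
    (hs' : (s' : W.subgroupH1 p κ.kerSubgroup) = W.conjH1 p κ.kerSubgroup g s) :
    ((twistDescentEquiv V K h2 hθ hc p κ hCW hp2 s' : chiEigenSelmer V K p κ) :
        V.subgroupH1 p (κ.kerSubgroup ⊓ galRange (K := ℚ) K)) =
      quadSign K g •
        V.conjH1 p _ g ((twistDescentEquiv V K h2 hθ hc p κ hCW hp2 s : chiEigenSelmer V K p κ) :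
          V.subgroupH1 p (κ.kerSubgroup ⊓ galRange (K := ℚ) K)) := by
  rw [coe_twistDescentEquiv, coe_twistDescentEquiv, hs']
  -- the change of model commutes with `g_*`
  have hm : (modelSubgroupH1Equiv p hCW κ.kerSubgroup).symm
      (W.conjH1 p κ.kerSubgroup g s) =
      (V.quadraticTwist c).conjH1 p κ.kerSubgroup g
        ((modelSubgroupH1Equiv p hCW κ.kerSubgroup).symm (s : W.subgroupH1 p κ.kerSubgroup)) := by
    apply (modelSubgroupH1Equiv p hCW κ.kerSubgroup).injective
    rw [AddEquiv.apply_symm_apply, modelSubgroupH1Equiv_conjH1, AddEquiv.apply_symm_apply]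
  rw [hm]
  -- restriction commutes with `g_*`
  have hr : (V.quadraticTwist c).resOfLe p
      (inf_le_left : κ.kerSubgroup ⊓ galRange (K := ℚ) K ≤ κ.kerSubgroup)
      ((V.quadraticTwist c).conjH1 p κ.kerSubgroup g
        ((modelSubgroupH1Equiv p hCW κ.kerSubgroup).symm (s : W.subgroupH1 p κ.kerSubgroup))) =
      (V.quadraticTwist c).conjH1 p _ g ((V.quadraticTwist c).resOfLe p
        (inf_le_left : κ.kerSubgroup ⊓ galRange (K := ℚ) K ≤ κ.kerSubgroup)
        ((modelSubgroupH1Equiv p hCW κ.kerSubgroup).symm (s : W.subgroupH1 p κ.kerSubgroup))) :=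
    congrArg (fun f ↦ f ((modelSubgroupH1Equiv p hCW κ.kerSubgroup).symm
        (s : W.subgroupH1 p κ.kerSubgroup)))
      (resOfLe_comp_conjH1_holds (M := geomPrimaryTorsion (V.quadraticTwist c) p)
        (inf_le_left : κ.kerSubgroup ⊓ galRange (K := ℚ) K ≤ κ.kerSubgroup) g)
  rw [hr]
  -- the twist, with its sign
  by_cases hg : g ∈ galRange (K := ℚ) K
  · rw [quadSign_of_mem K hg, one_smul,
      twistSubgroupH1EquivGeom_conjH1_of_mem V K hθ hc p _ inf_le_right hg]
  · rw [quadSign_of_not_mem K hg, neg_one_zsmul,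
      twistSubgroupH1EquivGeom_conjH1_of_not_mem V K h2 hθ hc p _ inf_le_right hg]

end Descent

end Summit.BirchSwinnertonDyer.Rank1Residual.AdditivePotMult

end
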